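import Summits.QuantumFields.YangMills.Theorems.SmallFieldWideningLargeFieldMassRefinementTailUnitTop

/-!
# Route `SmallFieldWidening`, crux r3 `LargeFieldMassRefinementTail` (stmt-QuantumFields-22884), line `birth` v6 — r3 NEEDS THE DEEP FIRST-EXIT TAIL
# ONLY FAMILY BY FAMILY: constants may depend on the torus `F` and on the coupling `γ`, and the bound is needed only at depths `≥ n₁(F, γ)`
# (support file; width seat `ym-line-sfw-p2-w2` gen 17; the stub `stub_firstExitDeep`, the crux and rung R3 stay OPEN)

WHAT THIS IS NOT.  No large-field estimate is proved; `stub_firstExitDeep` is not proved; nothing bears on the Yang–Mills mass gap; rung R3 (`YM3TorusSU2`)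
is a RECORD rung, not the Clay statement.  This file records, as a kernel theorem, HOW MUCH WEAKER crux r3 is than the one open registered stub of its
skeleton v6 (`stub_firstExitDeep`, shared verbatim with crux `FirstExitWindowTailL` of route `FirstExitWindow`, stmt-QuantumFields-26243).

THE POINT.  The stub (equivalently its unit-top normal form, `LargeFieldMassRefinementTailUnitTop.deepStub_iff_unitTop`) asks for constants `(γ₁, C, c, N)`
UNIFORM over all families `F` of block size `L` — all VOLUMES — and all `γ ≤ γ₁`.  Crux r3 does not need that: r3 is a statement about the REFINEMENTS
`F.refine n` of ONE family at the couplings `γL^{-n}`, and run `K` of `F.refine n` IS run `K + n` of `F` (same lattice, same Wilson weight; tree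
`gibbsK_refine_real_compl_histGood`), so every probability r3 mentions is a probability of the ONE family `F` at the ONE coupling `γ`, at depths `≥ n`
below its unit lattice; its null sequence `δ` is chosen AFTER `F` and `γ`.  Hence (§2, ★ `largeFieldMassRefinementTail_of_firstExitFam`):

  r3 ⇐ `FirstExitFam` := ∀ L, ∃ profile (0 < b₀, 2 < p₀), ∀ F (F.L = L), ∀ γ > 0, ∃ n₁ N C c (0 < c), ∀ K j, 2 ≤ j → j + n₁ ≤ K → ∀ p : Plaq (F.P K) j,
        Gibbs^F_K{ (∀ k < j, Ū^k is θ_{b₀}(K−k)-small) ∧ θ_{b₀}(K−j) ≤ |Ū^j(∂p) − 1| } ≤ C·β_{K−j}^N·exp(−c·p_{b₀}(g_{K−j})²)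

— the window-free deep first-exit tail of EACH family separately, at depths `K − j ≥ n₁(F, γ)` only, with `(n₁, N, C, c)` depending on `(F, γ)` and the
profile chosen by the supplier (one per block size).  By contrast the stub = `FirstExitFam` with `(C, c, N)` uniform in `(F, γ ≤ γ₁)`, `n₁ = 0`, every profile.
In particular a supplier whose constants grow with the volume (e.g. like `exp(R·(F.m+1)^q)`, the shape of route `LevelShiftBootstrap`'s cross-ratio, or with
any function of `F.m`) serves r3 as long as, along the refinements `F.refine d` (volume exponent `F.m + d`, coupling `γL^{-d}`), the growth in `d` is
absorbed by the Gaussian factor `exp(−c·p_{b₀}(g_d)²)`, `p_{b₀}(g_d) ≍ b₀(d·log L/2)^{p₀}` — see §1's transport `gibbsK_refine_real_firstExit_eq`, which turns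
«height `j` of run `K + d` of `F`» into «height `j` of run `K` of `F.refine d`» for every `j ≤ K` (the companion file did the case `j = K`).

THE PROOF of §2 is the landed first-exit engine of `LargeFieldMassRefinementTailOfFirstExit` (`exists_finestBad_profile`, `refine_real_compl_histGood_le`,
the bare profile `T3BareTailProfile.bareTailAt`, the landed first averaged level `FirstExitWindow.stub_firstExitOne` and the landed window
`firstExitWindow_oneStepWindowL_proof`) run on the ONE family `G = F.refine n₀`, `n₀ = max(n₁, least admissible depth)`, at `γ' = γL^{-n₀} ≤ 1`: the
first-exit bounds of `G` at all its heights `j ≥ 2` are first-exit bounds of `F` at depths `≥ n₀ ≥ n₁` (§1), the depths `n < n₀` are finitely many (`δ n ≥ 1`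
there), and deeper refinements are runs of `G` with free top steps.

References: T. Bałaban, Commun. Math. Phys. **102** (1985) 255–275 [Balaban1985UV3] ((1)–(3) p.256, (7) p.257, (71) p.273); CMP **109** (1987) 249–301
[Balaban1987RG1] ((0.1) p.251, (0.11) p.253).
-/

noncomputable section

open MeasureTheory Filter Topology
open Literature.MathematicalPhysics.QuantumFieldTheory.Balaban1983to89
open Literature.MathematicalPhysics.QuantumFieldTheory.Balaban1983to89.Missing
open Literature.MathematicalPhysics.QuantumFieldTheory.Balaban1983to89.T3ContinuumYM3Torus
open Literature.MathematicalPhysics.QuantumFieldTheory.Balaban1983to89.T3UnitScaleTilt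
open Literature.MathematicalPhysics.QuantumFieldTheory.Balaban1983to89.T3UnitLawDensityEML (ℰp measurableE_ℰp)
open Literature.MathematicalPhysics.QuantumFieldTheory.Balaban1983to89.T3LevelShift
open Literature.MathematicalPhysics.QuantumFieldTheory.Balaban1983to89.T3ThresholdRemoval
open Literature.MathematicalPhysics.QuantumFieldTheory.Balaban1983to89.T3BareTailProfile
open Summit.QuantumFields.YangMills.Theorems.HistoryTailOfTwoSided (geometric_profile)
open Summit.QuantumFields.YangMills.Theorems.LargeFieldMassRefinementTailOfHeightTail (θBal_mul_pow plaqSmall_fieldShift_iff refine_refine)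
open Summit.QuantumFields.YangMills.Theorems.LargeFieldMassRefinementTailOfFirstExit (exists_finestBad_profile refine_real_compl_histGood_le)
open Summit.QuantumFields.YangMills.Theorems.LargeFieldMassRefinementTailUnitTop (gibbsMeasure_real_preimage_fieldShift)
open Summit.QuantumFields.YangMills.Theorems.FirstExitWindow (tail_bound_mono one_le_inv_coupling)

namespace Summit.QuantumFields.YangMills.Theorems.LargeFieldMassRefinementTailPerFamily

/-! ## §1 Height `j` of run `K + d` of `F` is height `j` of run `K` of `F.refine d` (every `j ≤ K`) -/

section Transport

variable (F : T3Family)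

/-- **THE WINDOW-FREE FIRST-EXIT EVENT UNDER THE LEVEL SHIFT, EVERY HEIGHT**: for `γ ≥ 0`, a profile `(b₀, p₀)`, a depth `d`, a run `K`, a height `j ≤ K`
and a level-`j` plaquette `p` of run `K + d` of `F`, the Gibbs mass (run `K` of `F.refine d` at `γL^{-d}`) of «`∀ k < j`, `Ū^k` is `θ_{γL^{-d}}(K−k)`-small ∧
`θ_{γL^{-d}}(K−j) ≤ |Ū^j(∂(plaqShift p)) − 1|» EQUALS the Gibbs mass (run `K + d` of `F` at `γ`) of «`∀ k < j`, `Ū^k` is `θ_γ(K+d−k)`-small ∧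
`θ_γ(K+d−j) ≤ |Ū^j(∂p) − 1|» (same finest lattice and Wilson weight `refine_β`, block averagings and plaquettes corresponding under `fieldShift`,
`θ_{γL^{-d}}(i) = θ_γ(i + d)`).  The companion file's `gibbsK_real_firstExit_eq_refine` is the case `j = K`.
[cite: Balaban1985UV3, (1)-(3) p.256 and (7) p.257; Balaban1987RG1, (0.11) p.253] -/
theorem gibbsK_refine_real_firstExit_eq (γ : ℝ) (hγ : 0 ≤ γ) (b₀ p₀ : ℝ) (d K j : ℕ) (hj : j ≤ K) (p : Plaq (F.P (K + d)) j) :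
    (gibbsK (F.refine d) ℰp (γ * ((F.L : ℝ)⁻¹) ^ d) K).real
        {V | (∀ k, k < j → PlaqSmall (θBal F.L (γ * ((F.L : ℝ)⁻¹) ^ d) b₀ p₀ (K - k))
            (Averaging.iter (fun i => BlockAveraging.blockAvg (P := (F.refine d).P K) (j := i) ℰp) k V)) ∧
          θBal F.L (γ * ((F.L : ℝ)⁻¹) ^ d) b₀ p₀ (K - j) ≤ GaugeGroup.dist1 (GaugeField.plaqHol
            (Averaging.iter (fun i => BlockAveraging.blockAvg (P := (F.refine d).P K) (j := i) ℰp) j V)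
            (plaqShift (F.sitesPerDir_eq (m := F.m) (K := K + d) (j := j) (m' := F.m + d) (K' := K) (j' := j) (by omega)) p))} =
      (gibbsK F ℰp γ (K + d)).real {U | (∀ k, k < j → PlaqSmall (θBal F.L γ b₀ p₀ (K + d - k))
          (Averaging.iter (fun i => BlockAveraging.blockAvg (P := F.P (K + d)) (j := i) ℰp) k U)) ∧
        θBal F.L γ b₀ p₀ (K + d - j) ≤ GaugeGroup.dist1 (GaugeField.plaqHol
          (Averaging.iter (fun i => BlockAveraging.blockAvg (P := F.P (K + d)) (j := i) ℰp) j U) p)} := by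
  have hmK : F.m + (K + d) = F.m + d + K := by omega
  have hβ : ((F.refine d).scheme ℰp (γ * ((F.L : ℝ)⁻¹) ^ d)).β K = (F.scheme ℰp γ).β (K + d) := F.refine_β ℰp γ d K
  have hβ0 : 0 ≤ (F.scheme ℰp γ).β (K + d) := F.scheme_β_nonneg ℰp hγ (K + d)
  rw [gibbsK_eq, gibbsK_eq, hβ]
  refine ((gibbsMeasure_real_preimage_fieldShift (G := Matrix.specialUnitaryGroup (Fin 2) ℂ)
    (sitesPerDir_refine_zero F d K) hβ0 _).symm.trans ?_).symm
  congr 1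
  ext V
  simp only [Set.mem_preimage]
  simp only [θBal_mul_pow]
  constructor
  · rintro ⟨hhist, hexit⟩
    refine ⟨fun k hk => ?_, ?_⟩
    · have hk' := hhist k hk
      have key := iter_fieldShift ℰp hmK k V
      erw [key, plaqSmall_fieldShift_iff] at hk'
      rw [show K + d - k = K - k + d by omega] at hk'
      exact hk'
    · have key := iter_fieldShift ℰp hmK j V
      erw [key, plaqHol_fieldShift] at hexit
      rw [show K + d - j = K - j + d by omega] at hexit
      exact hexit
  · rintro ⟨hhist, hexit⟩
    refine ⟨fun k hk => ?_, ?_⟩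
    · have hk' := hhist k hk
      have key := iter_fieldShift ℰp hmK k V
      erw [key, plaqSmall_fieldShift_iff]
      rw [show K + d - k = K - k + d by omega]
      exact hk'
    · have key := iter_fieldShift ℰp hmK j V
      erw [key, plaqHol_fieldShift]
      rw [show K + d - j = K - j + d by omega]
      exact hexit

end Transport

/-! ## §2 Crux r3 from the per-family deep first-exit tail -/

section PerFamily

/-- ★ **r3 NEEDS THE DEEP FIRST-EXIT TAIL ONLY FAMILY BY FAMILY.**  If for every block size `L` there is a profile `(b₀, p₀)` (`0 < b₀`, `2 < p₀`) such that
EVERY family `F` of block size `L` at EVERY coupling `γ > 0` has, for SOME `n₁, N, C, c` (depending on `F` and `γ`), the window-free deep first-exit bound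
`Gibbs^F_K{ (∀ k<j, Ū^k is θ_{b₀}(K−k)-small) ∧ θ_{b₀}(K−j) ≤ |Ū^j(∂p) − 1| } ≤ C·β_{K−j}^N·exp(−c·p_{b₀}(g_{K−j})²)` at all heights `2 ≤ j` and depths
`K − j ≥ n₁`, then crux r3 `LargeFieldMassRefinementTail` (stmt-QuantumFields-22884) holds — with the landed bare profile, first averaged level
(`FirstExitWindow.stub_firstExitOne`) and window (`firstExitWindow_oneStepWindowL_proof`) supplying the heights `j ≤ 1`, and the landed engine of
`LargeFieldMassRefinementTailOfFirstExit` run on the ONE family `F.refine n₀`, `n₀ = max(n₁, least admissible depth)`.  Conditional certificate: the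
hypothesis (weaker than `stub_firstExitDeep`, whose constants are uniform in the family and in `γ ≤ γ₁`) is NOT proved; nothing about the mass gap.
[cite: Balaban1985UV3, (7) p.257 and (71) p.273] -/
theorem largeFieldMassRefinementTail_of_firstExitFam
    (hfam : ∀ L : ℕ, ∃ (b₀ p₀ : ℝ), 0 < b₀ ∧ 2 < p₀ ∧ ∀ (F : T3Family) (γ : ℝ), F.L = L → 0 < γ →
      ∃ (n₁ N : ℕ) (C c : ℝ), 0 < c ∧ ∀ (K j : ℕ), 2 ≤ j → j + n₁ ≤ K → ∀ p : Plaq (F.P K) j,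
        (gibbsK F ℰp γ K).real {U | (∀ k, k < j → PlaqSmall (θBal F.L γ b₀ p₀ (K - k))
            (Averaging.iter (fun i => BlockAveraging.blockAvg (P := F.P K) (j := i) ℰp) k U)) ∧
          θBal F.L γ b₀ p₀ (K - j) ≤ GaugeGroup.dist1 (GaugeField.plaqHol
            (Averaging.iter (fun i => BlockAveraging.blockAvg (P := F.P K) (j := i) ℰp) j U) p)} ≤
        C * ((γ * ((F.L : ℝ)⁻¹) ^ (K - j))⁻¹) ^ N * Real.exp (-(c * B10.pFun b₀ p₀ (Real.sqrt (γ * ((F.L : ℝ)⁻¹) ^ (K - j))) ^ 2))) :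
    Summit.QuantumFields.YangMills.Theses.SmallFieldWidening.LargeFieldMassRefinementTail := by
  classical
  intro L
  obtain ⟨b₀, p₀, hb₀, hp₀, hfam⟩ := hfam L
  have hp₀1 : 1 ≤ p₀ := by linarith
  -- the landed window and first averaged level (uniform in the family)
  obtain ⟨b₂, γW, hb₂, hγW, hγW1, hwin⟩ := firstExitWindow_oneStepWindowL_proof L b₀ p₀ hb₀ hp₀
  obtain ⟨γ₁, C₁, c₁, N₁, hγ₁, hγ₁1, hc₁, hC₁, h1⟩ := FirstExitWindow.stub_firstExitOne L b₀ p₀ b₂ hb₀ hp₀ hb₂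
  refine ⟨b₀, p₀, min γW γ₁, hb₀, hp₀, lt_min hγW hγ₁, fun F γ hFL hγ => ?_⟩
  obtain ⟨n₁, N, C, c, hc, hFE⟩ := hfam F γ hFL hγ
  have hL0 : (0 : ℝ) < F.L := by exact_mod_cast (zero_lt_one.trans F.hL.2)
  have hL1 : (1 : ℝ) ≤ F.L := by exact_mod_cast F.hL.2.le
  have hq1 : ((F.L : ℝ)⁻¹) ≤ 1 := inv_le_one_of_one_le₀ hL1
  have hq0 : (0 : ℝ) ≤ ((F.L : ℝ)⁻¹) := inv_nonneg.mpr hL0.le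
  by_cases hex : ∃ n : ℕ, γ * ((F.L : ℝ)⁻¹) ^ n ≤ min γW γ₁
  · -- the working depth `n₀ = max(n₁, least admissible depth)` and the ONE family `G = F.refine n₀` at `γ' = γL^{-n₀} ≤ 1`
    set n₀ : ℕ := max (Nat.find hex) n₁ with hn₀def
    have hn₀find : Nat.find hex ≤ n₀ := le_max_left _ _
    have hn₀n₁ : n₁ ≤ n₀ := le_max_right _ _
    set γ' : ℝ := γ * ((F.L : ℝ)⁻¹) ^ n₀ with hγ'def
    have hγ' : 0 < γ' := mul_pos hγ (pow_pos (inv_pos.mpr hL0) _)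
    have hγ'le : γ' ≤ min γW γ₁ :=
      (mul_le_mul_of_nonneg_left (pow_le_pow_of_le_one hq0 hq1 hn₀find) hγ.le).trans (Nat.find_spec hex)
    have hγ'W : γ' ≤ γW := hγ'le.trans (min_le_left _ _)
    have hγ'1' : γ' ≤ γ₁ := hγ'le.trans (min_le_right _ _)
    have hγ'1 : γ' ≤ 1 := hγ'1'.trans hγ₁1
    set G : T3Family := F.refine n₀ with hGdef
    have hGL : G.L = L := hFL
    -- the first-exit bounds of `G` at every height `j ≥ 1`, constants `(max C₁ (max C 0), min c₁ c, max N₁ N)`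
    have hCC : 0 ≤ max C 0 := le_max_right _ _
    have hFE_G : ∀ K j : ℕ, 1 ≤ j → j ≤ K → ∀ p : Plaq (G.P K) j, (gibbsK G ℰp γ' K).real
        {U | (∀ k, k < j → PlaqSmall (θBal G.L γ' b₀ p₀ (K - k))
            (Averaging.iter (fun i => BlockAveraging.blockAvg (P := G.P K) (j := i) ℰp) k U)) ∧
          PlaqSmall (θBal G.L γ' b₂ p₀ (K - j))
            (Averaging.iter (fun i => BlockAveraging.blockAvg (P := G.P K) (j := i) ℰp) j U) ∧
          θBal G.L γ' b₀ p₀ (K - j) ≤ GaugeGroup.dist1 (GaugeField.plaqHol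
            (Averaging.iter (fun i => BlockAveraging.blockAvg (P := G.P K) (j := i) ℰp) j U) p)} ≤
        max C₁ (max C 0) * ((γ' * ((G.L : ℝ)⁻¹) ^ (K - j))⁻¹) ^ (max N₁ N) *
          Real.exp (-(min c₁ c * B10.pFun b₀ p₀ (Real.sqrt (γ' * ((G.L : ℝ)⁻¹) ^ (K - j))) ^ 2)) := by
      intro K j hj1 hjK p
      have hGL1 : 1 ≤ G.L := le_of_lt G.hL.2
      have hβ1 : 1 ≤ (γ' * ((G.L : ℝ)⁻¹) ^ (K - j))⁻¹ := one_le_inv_coupling hGL1 hγ' hγ'1 (K - j)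
      have hx : 0 ≤ B10.pFun b₀ p₀ (Real.sqrt (γ' * ((G.L : ℝ)⁻¹) ^ (K - j))) ^ 2 := sq_nonneg _
      rcases Nat.lt_or_ge j 2 with hj | hj
      · -- `j = 1`: the landed first averaged level (uniform constants)
        obtain rfl : j = 1 := by omega
        exact (h1 G γ' hGL hγ' hγ'1' K hjK p).trans
          (tail_bound_mono hβ1 hC₁ (le_max_left _ _) (le_max_left _ _) (min_le_left _ _) hx)
      · -- `j ≥ 2`: the family's own deep bound at depth `K - j + n₀ ≥ n₁`, transported to `G = F.refine n₀` (window dropped)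
        haveI := isProbabilityMeasure_gibbsK G ℰp hγ'.le K
        obtain ⟨e, rfl⟩ := Nat.exists_eq_add_of_le hjK
        -- `K = j + e`; the plaquette of `F`'s run `j + e + n₀` corresponding to `p`
        have hshape : (gibbsK G ℰp γ' (j + e)).real
            {U | (∀ k, k < j → PlaqSmall (θBal G.L γ' b₀ p₀ (j + e - k))
                (Averaging.iter (fun i => BlockAveraging.blockAvg (P := G.P (j + e)) (j := i) ℰp) k U)) ∧
              θBal G.L γ' b₀ p₀ (j + e - j) ≤ GaugeGroup.dist1 (GaugeField.plaqHol
                (Averaging.iter (fun i => BlockAveraging.blockAvg (P := G.P (j + e)) (j := i) ℰp) j U) p)} ≤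
            max C 0 * ((γ' * ((G.L : ℝ)⁻¹) ^ (j + e - j))⁻¹) ^ N *
              Real.exp (-(c * B10.pFun b₀ p₀ (Real.sqrt (γ' * ((G.L : ℝ)⁻¹) ^ (j + e - j))) ^ 2)) := by
          -- read `p` as the image of a plaquette of run `(j + e) + n₀` of `F`
          set h₀ := F.sitesPerDir_eq (m := F.m) (K := j + e + n₀) (j := j) (m' := F.m + n₀) (K' := j + e) (j' := j) (by omega)
            with hh₀
          obtain ⟨p', rfl⟩ : ∃ p' : Plaq (F.P (j + e + n₀)) j, p = plaqShift h₀ p' :=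
            ⟨(plaqShift h₀).symm p, ((plaqShift h₀).apply_symm_apply p).symm⟩
          have key := gibbsK_refine_real_firstExit_eq F γ hγ.le b₀ p₀ n₀ (j + e) j (Nat.le_add_right j e) p'
          -- `G.L = F.L`, `γ' = γ L^{-n₀}`
          have hGF : (G.L : ℝ) = F.L := by rw [show G.L = F.L from rfl]
          rw [hGF]
          erw [key]
          have happ := hFE (j + e + n₀) j hj (by omega) p'
          refine happ.trans ?_
          -- same bound: `γ·L^{-(j+e+n₀-j)} = γ'·L^{-(j+e-j)}`
          have hcoup : γ * ((F.L : ℝ)⁻¹) ^ (j + e + n₀ - j) = γ' * ((F.L : ℝ)⁻¹) ^ (j + e - j) := by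
            rw [show j + e + n₀ - j = n₀ + (j + e - j) by omega, pow_add, hγ'def, mul_assoc]
          rw [hcoup]
          have hβ0 : 0 ≤ (γ' * ((F.L : ℝ)⁻¹) ^ (j + e - j))⁻¹ :=
            inv_nonneg.mpr (mul_nonneg hγ'.le (pow_nonneg hq0 _))
          exact mul_le_mul_of_nonneg_right (mul_le_mul_of_nonneg_right (le_max_left C 0) (pow_nonneg hβ0 N))
            (Real.exp_nonneg _)
        refine (measureReal_mono ?_ (measure_ne_top _ _)).trans (hshape.trans
          (tail_bound_mono hβ1 hCC (le_max_right _ _) (le_max_right _ _) (min_le_right _ _) hx))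
        intro U hU
        exact ⟨hU.1, hU.2.2⟩
    -- the two profiles of the ONE family `G`
    obtain ⟨q₀, hq₀0, hq₀, -, hbare⟩ := bareTailAt G hγ' hγ'1 hb₀ hp₀1
    obtain ⟨A', hA'0, hfb⟩ := exists_finestBad_profile G hγ' hγ'1 hb₀ hp₀1
      (fun K j hjK U hU => hwin G γ' hGL hγ' hγ'W K j hjK U hU) (lt_min hc₁ hc) hFE_G
    obtain ⟨hg0, hg, -⟩ := geometric_profile hA'0
    -- the null sequence: `1` below the working depth, the two tail sums from it on
    refine ⟨fun n => (if n < n₀ then (1 : ℝ) else 0) + ((∑' t, q₀ (t + (n - n₀))) +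
      ∑' t, A' * ((1 : ℝ) / 2) ^ (t + (n - n₀))), ?_, fun n K hle => ?_⟩
    · have h0 := (tendsto_sum_nat_add q₀).comp (tendsto_sub_atTop_nat n₀)
      have h1' := (tendsto_sum_nat_add (fun i : ℕ => A' * ((1 : ℝ) / 2) ^ i)).comp (tendsto_sub_atTop_nat n₀)
      have hind : Tendsto (fun n : ℕ => if n < n₀ then (1 : ℝ) else 0) atTop (𝓝 0) := by
        refine tendsto_const_nhds.congr' ?_
        filter_upwards [eventually_ge_atTop n₀] with n hn
        rw [if_neg (not_lt.mpr hn)]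
      have h := hind.add (h0.add h1')
      simpa using h
    · haveI := isProbabilityMeasure_gibbsK (F.refine n) ℰp
        (mul_nonneg hγ.le (pow_nonneg hq0 n)) K
      have htails : 0 ≤ (∑' t, q₀ (t + (n - n₀))) + ∑' t, A' * ((1 : ℝ) / 2) ^ (t + (n - n₀)) :=
        add_nonneg (tsum_nonneg fun t => hq₀0 _) (tsum_nonneg fun t => hg0 _)
      beta_reduce
      by_cases hn : n < n₀
      · -- finitely many shallow depths: the trivial bound
        rw [if_pos hn]
        exact (measureReal_le_one).trans (le_add_of_nonneg_right htails)
      · rw [if_neg hn, zero_add]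
        obtain ⟨d, rfl⟩ : ∃ d, n = n₀ + d := ⟨n - n₀, by omega⟩
        have hd : n₀ + d - n₀ = d := Nat.add_sub_cancel_left _ _
        have hc' : γ * ((F.L : ℝ)⁻¹) ^ (n₀ + d) = γ' * ((F.L : ℝ)⁻¹) ^ d := by rw [pow_add, hγ'def, mul_assoc]
        rw [hd]
        have hGr : F.refine (n₀ + d) = G.refine d := (refine_refine F n₀ d).symm
        have hLG : (F.L : ℝ) = G.L := by rw [show G.L = F.L from rfl]
        -- move to the family `G` and its run `K` at depth `d`
        have goal := refine_real_compl_histGood_le G hγ'.le b₀ p₀ hg0 hg hbare hfb d K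
        rw [← hGr, ← hLG, ← hc'] at goal
        refine goal.trans ?_
        have h1'' : q₀ (K + d) ≤ ∑' t, q₀ (t + d) := by
          have := ((summable_nat_add_iff d).mpr hq₀).sum_le_tsum {K} (fun t _ => hq₀0 (t + d))
          simpa using this
        exact add_le_add h1'' le_rfl
  · exact ⟨fun _ => 0, tendsto_const_nhds, fun n K hle => (hex ⟨n, hle⟩).elim⟩

end PerFamily

end Summit.QuantumFields.YangMills.Theorems.LargeFieldMassRefinementTailPerFamily

end
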